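import Summits.BirchSwinnertonDyer.Rank1Residual.Additive.KatoDescentAdmissibleIstarZero
import HarnessLib

set_option autoImplicit false

/-!
# The OFF-`μ` half of Kato's 12.10 length equality ON THE ROWS of stmt-BirchSwinnertonDyer-19223 (`(p, I₀*)`, `p ≥ 5`) FROM
# THE PRINTED THEOREM Burungale–Tian 2026 Thm. 2.6 (the CM case of Kato 12.10 in `Λ ⊗ ℚ`), and the recomposition of the v7/v8
# length-equality slot from {that theorem, the `μ`-equality stub}

Seat `bsd-cm-prr-ty1` (generation 20, literature-prover; cell `bsd-cm`, HOME `run/shared/lean/pub/bsd-cm/`), item (T20-F) (planner GO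
D748 (2)(c)).  THEOREMS ONLY; no `def`, no named fact, no instance, no notation, no `sorry`.  The Literature-side named fact
`Literature.NumberTheory.EllipticCurves.Kato2004.BurungaleTian2026_lengthEq_offMu_of_hasCM`
(`Literature/NumberTheory/EllipticCurves/Kato2004/KatoMainConjectureCMOffMu.lean`, filed with this file) is consumed here BY VALUE —
the hypothesis `hfact` below is its `def` body VERBATIM — so this file does not import it and the registered skeleton can feed the
fact term itself (`def` unfolding at the call), exactly as p731778 `…_of_cmFact` consumes F-CM.

* `StrictCount.katoLengthEqualityOffMu_istarZero_of_fact (hfact) : ⟨OFF-μ clause of p735452 VERBATIM⟩` — on the rows, `W.HasCM` is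
  the first conjunct of `HasSignedLocalType W p (.Istar 0)` and `p ≠ 2` follows from `5 ≤ p`; nothing else is used.
* `StrictCount.katoLengthEquality_istarZero_of_fact_of_atMu (hfact) (hat : ⟨AT-μ clause⟩) : ⟨v7 stub 2 VERBATIM⟩` — the v9
  `lengthEq_closed` in one call (the `by_cases` of p735452 `…of_offMu_of_atMu` inlined, so that this file imports only p731778 and
  does not wait on p735452's olean; the two recompositions agree definitionally in effect).

HONEST LABEL: conditional re-keyings; nothing asserted; no stub closed; 19223 stays OPEN; `X12.CMInertBad` NOT proved; the `μ`-equality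
(`𝔮 = (p)`) is research (Burungale–Tian Rem. 2.7); BSD is proved for no curve.

References: A. Burungale, Y. Tian, Ann. of Math. 203 (2026) Thm. 2.6, Rem. 2.7 [BurungaleTian2026]; K. Kato, Astérisque 295 (2004)
Conj. 12.10 (p. 224), (14.9.1) (p. 239), Prop. 15.17 (p. 265) [Kato2004Asterisque]; tree p735452 `KatoDescentLengthEqualityMuSplit.lean`,
p731778 `KatoDescentAdmissibleIstarZero.lean`; memo pub/bsd-cm/bsd-cm-prr-ty1/g20/LENGTH-EQUALITY-AUDIT.md.
-/

noncomputable section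

open scoped Classical NumberField

open WeierstrassCurve Field IsDedekindDomain NumberField Rat.HeightOneSpectrum Literature.NumberTheory.EllipticCurves
  Literature.NumberTheory.EllipticCurves.Rank1Residual Literature.NumberTheory.EllipticCurves.Rank1Residual.Typed
  Literature.NumberTheory.EllipticCurves.Kato2004 Literature.NumberTheory.EllipticCurves.IwasawaAlgebra
  Literature.NumberTheory.GaloisRepresentations
open Summit.BirchSwinnertonDyer.Rank1Residual Summit.BirchSwinnertonDyer.Rank1Residual.Additive
  Summit.BirchSwinnertonDyer.Rank1Residual.X12.O10

namespace Summit.BirchSwinnertonDyer.Rank1Residual.Additive.StrictCount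

/-- **The OFF-`μ` length equality on the rows `(p, I₀*)`, `p ≥ 5`, from Burungale–Tian 2026 Thm. 2.6** (the body of
`Kato2004.BurungaleTian2026_lengthEq_offMu_of_hasCM`, hypothesis `hfact`, VERBATIM): for every rank-one pair of the type, every
cyclotomic datum, pin, admissible `z₀`, dual fine Selmer datum of key `γ⁻¹` and height-one `𝔮 ≠ (p)`,
`length_𝔮 Y.X = length_𝔮 (𝐇¹ ⧸ Λz₀)` — the conclusion is the OFF-`μ` clause of p735452
`katoLengthEquality_istarZero_of_offMu_of_atMu` (= registered `stub_katoLengthEqualityOffMuIstarZero` of istar v8) VERBATIM.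
On the rows `W.HasCM` is `hT.1` and `p ≠ 2` is `5 ≤ p`; the rank hypothesis is not used.  CONDITIONAL on `hfact`; nothing asserted.
[cite: BurungaleTian2026, Thm. 2.6 (p. 5)] [cite: Kato2004Asterisque, Conj. 12.10 (p. 224); Prop. 15.17 (p. 265)] -/
theorem katoLengthEqualityOffMu_istarZero_of_fact
    (hfact : ∀ (W : WeierstrassCurve ℚ) [W.IsElliptic] [W.IsGloballyMinimal] (p : ℕ) [Fact p.Prime]
      [ContinuousSMul ℤ_[p] (W.tateModule p)] (κ : ZpExtension ℚ p) (γ : absoluteGaloisGroup ℚ)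
      (hκ : κ.IsCyclotomic), κ.IsTopGenerator γ → p ≠ 2 → W.HasCM →
        ∀ (I : IwasawaH1Data W p κ γ) (z₀ : I.H), IsAdmissibleZetaClass W p κ hκ I z₀ →
          ∀ (Y : W.FineSelmerDualData κ γ⁻¹) (𝔮 : PrimeSpectrum (IwasawaAlgebra p)), 𝔮.asIdeal.height = 1 →
            𝔮.asIdeal ≠ IwasawaAlgebra.augIdealP p →
            Module.lengthAt (IwasawaAlgebra p) Y.X 𝔮 =
              Module.lengthAt (IwasawaAlgebra p) (I.H ⧸ (IwasawaAlgebra p) ∙ z₀) 𝔮) :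
    ∀ (p : ℕ) [Fact p.Prime], 5 ≤ p → ∀ (W : WeierstrassCurve ℚ) [W.IsElliptic] [W.IsGloballyMinimal],
      HasSignedLocalType W p (.Istar 0) → W.analyticRank = 1 →
      letI : ContinuousSMul ℤ_[p] (W.tateModule p) := TateModule.continuousSMul_padicInt
      ∀ (K : ZpExtension ℚ p) (hK : K.IsCyclotomic) (γ : absoluteGaloisGroup ℚ) (_ : K.IsTopGenerator γ)
        (I : IwasawaH1Data W p K γ) (z₀ : I.H), IsAdmissibleZetaClass W p K hK I z₀ →
        ∀ (Y : W.FineSelmerDualData K γ⁻¹) (𝔮 : PrimeSpectrum (IwasawaAlgebra p)), 𝔮.asIdeal.height = 1 →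
          𝔮.asIdeal ≠ IwasawaAlgebra.augIdealP p →
          Module.lengthAt (IwasawaAlgebra p) Y.X 𝔮 =
            Module.lengthAt (IwasawaAlgebra p) (I.H ⧸ (IwasawaAlgebra p) ∙ z₀) 𝔮 := by
  intro p _ hp5 W _ _ hT _ K hK γ hγ I z₀ hz₀ Y 𝔮 h𝔮 hne
  letI : ContinuousSMul ℤ_[p] (W.tateModule p) := TateModule.continuousSMul_padicInt
  exact hfact W p K γ hK hγ (by omega) hT.1 I z₀ hz₀ Y 𝔮 h𝔮 hne

/-- **The v7 length-equality slot (p731778's `hlen`, v8's `lengthEq_closed` type) from {Burungale–Tian 2.6 BY VALUE, the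
`μ`-equality clause}** in one call (p735452's `by_cases` inlined).  The shape of istar v9's `lengthEq_closed` once the
named fact is a conjunct of `stub_printFactsKato` (planner D748 (3)).  CONDITIONAL on both hypotheses; nothing asserted; the `μ`-clause
is research (Rem. 2.7). [cite: BurungaleTian2026, Thm. 2.6, Remark 2.7 (p. 5)] [cite: Kato2004Asterisque, Conj. 12.10 (p. 224)] -/
theorem katoLengthEquality_istarZero_of_fact_of_atMu
    (hfact : ∀ (W : WeierstrassCurve ℚ) [W.IsElliptic] [W.IsGloballyMinimal] (p : ℕ) [Fact p.Prime]
      [ContinuousSMul ℤ_[p] (W.tateModule p)] (κ : ZpExtension ℚ p) (γ : absoluteGaloisGroup ℚ)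
      (hκ : κ.IsCyclotomic), κ.IsTopGenerator γ → p ≠ 2 → W.HasCM →
        ∀ (I : IwasawaH1Data W p κ γ) (z₀ : I.H), IsAdmissibleZetaClass W p κ hκ I z₀ →
          ∀ (Y : W.FineSelmerDualData κ γ⁻¹) (𝔮 : PrimeSpectrum (IwasawaAlgebra p)), 𝔮.asIdeal.height = 1 →
            𝔮.asIdeal ≠ IwasawaAlgebra.augIdealP p →
            Module.lengthAt (IwasawaAlgebra p) Y.X 𝔮 =
              Module.lengthAt (IwasawaAlgebra p) (I.H ⧸ (IwasawaAlgebra p) ∙ z₀) 𝔮)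
    (hat : ∀ (p : ℕ) [Fact p.Prime], 5 ≤ p → ∀ (W : WeierstrassCurve ℚ) [W.IsElliptic] [W.IsGloballyMinimal],
      HasSignedLocalType W p (.Istar 0) → W.analyticRank = 1 →
      letI : ContinuousSMul ℤ_[p] (W.tateModule p) := TateModule.continuousSMul_padicInt
      ∀ (K : ZpExtension ℚ p) (hK : K.IsCyclotomic) (γ : absoluteGaloisGroup ℚ) (_ : K.IsTopGenerator γ)
        (I : IwasawaH1Data W p K γ) (z₀ : I.H), IsAdmissibleZetaClass W p K hK I z₀ →
        ∀ (Y : W.FineSelmerDualData K γ⁻¹) (𝔮 : PrimeSpectrum (IwasawaAlgebra p)), 𝔮.asIdeal.height = 1 →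
          𝔮.asIdeal = IwasawaAlgebra.augIdealP p →
          Module.lengthAt (IwasawaAlgebra p) Y.X 𝔮 =
            Module.lengthAt (IwasawaAlgebra p) (I.H ⧸ (IwasawaAlgebra p) ∙ z₀) 𝔮) :
    ∀ (p : ℕ) [Fact p.Prime], 5 ≤ p → ∀ (W : WeierstrassCurve ℚ) [W.IsElliptic] [W.IsGloballyMinimal],
      HasSignedLocalType W p (.Istar 0) → W.analyticRank = 1 →
      letI : ContinuousSMul ℤ_[p] (W.tateModule p) := TateModule.continuousSMul_padicInt
      ∀ (K : ZpExtension ℚ p) (hK : K.IsCyclotomic) (γ : absoluteGaloisGroup ℚ) (_ : K.IsTopGenerator γ)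
        (I : IwasawaH1Data W p K γ) (z₀ : I.H), IsAdmissibleZetaClass W p K hK I z₀ →
        ∀ (Y : W.FineSelmerDualData K γ⁻¹) (𝔮 : PrimeSpectrum (IwasawaAlgebra p)), 𝔮.asIdeal.height = 1 →
          Module.lengthAt (IwasawaAlgebra p) Y.X 𝔮 =
            Module.lengthAt (IwasawaAlgebra p) (I.H ⧸ (IwasawaAlgebra p) ∙ z₀) 𝔮 := by
  intro p _ hp5 W _ _ hT hr K hK γ hγ I z₀ hz₀ Y 𝔮 h𝔮
  by_cases h : 𝔮.asIdeal = IwasawaAlgebra.augIdealP p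
  · exact hat p hp5 W hT hr K hK γ hγ I z₀ hz₀ Y 𝔮 h𝔮 h
  · exact katoLengthEqualityOffMu_istarZero_of_fact hfact p hp5 W hT hr K hK γ hγ I z₀ hz₀ Y 𝔮 h𝔮 h

end Summit.BirchSwinnertonDyer.Rank1Residual.Additive.StrictCount

end
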